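import Literature.NumberTheory.EllipticCurves.CMNewformGamma0PrimitiveIsNewform
import Literature.NumberTheory.EllipticCurves.CMNewformGamma0OfGrossencharakterProofs
import Literature.NumberTheory.EllipticCurves.NewformOfLevelFunctionalEquationProofs
import Literature.NumberTheory.EllipticCurves.HeckeGrossencharakterFunctionalEquationConductor
import Literature.NumberTheory.EllipticCurves.HeckeCharacterConjugateEquivariance
import Literature.NumberTheory.EllipticCurves.NewformsLiftProofs
import Literature.NumberTheory.EllipticCurves.DeuringGrossencharacterPinnedRigidity
import Literature.NumberTheory.GaloisRepresentations.GrossencharakterPrimitive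
import Literature.NumberTheory.GaloisRepresentations.HeckeCharacterConductor
import Literature.NumberTheory.GaloisRepresentations.HeckeLFunctionValueOfNegativeWeight
import HarnessLib

/-!
# Shimura's remark «`θ_ψ` is a newform of level EXACTLY `|d_K|·N𝔣` for `𝔣` the conductor of `ψ`» — PROVED modulo
# Hecke's functional equation (conductor pinned): `shimura1972_heckeTheta_isNewform0_of_primitive_of_heckeFE`

Topic `NumberTheory/EllipticCurves`; namespace `Literature.NumberTheory.EllipticCurves.ModularForms`.  A `…Proofs` file (theorems
only: no definition, no named fact, no instance; D-0026) for the named fact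
`ModularForms.shimura1972_heckeTheta_isNewform0_of_primitive` (`CMNewformGamma0PrimitiveIsNewform.lean`: Ribet 1977 §3
Remark (3.5) = Shimura, Ann. of Math. 95 (1972), p. 138 / Nagoya Math. J. 43 (1971), Lemma 3 = Miyake Thm. 4.8.2): **it FOLLOWS from
Hecke's functional equation for Größencharaktere of infinity type `(m, 0)` WITH ITS CONDUCTOR**, the named fact
`Hecke_functionalEquation_infinityType_conductor` (`HeckeGrossencharakterFunctionalEquationConductor.lean`; Hecke 1920, de Shalit
II.1.1 (1)–(3), Neukirch VII (8.5)–(8.6)) — ★★ `shimura1972_heckeTheta_isNewform0_of_primitive_of_heckeFE`.  (Shimura's and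
Miyake's printed proofs run through Weil's converse theorem / the functional equations of twists; Li's newness criterion
`isNewform0_of_functionalEquation_conj` (`NewformOfLevelFunctionalEquationProofs.lean`) needs only the ONE functional equation of
`L(ψ, s)` itself, because the theta coefficients at the level primes are geometric with `‖ψ(𝔭)‖² = ℓ^{k−1} ≠ ℓ^{k−2}`.)

PROOF.  Let `ψ mod 𝔣` be primitive of type `σ^{k−1}` with `ψ((n)) = (d_K/n)n^{k−1}`, `N = |d_K|·N𝔣`, and `g ∈ S_k(Γ₀(N))` with
`a_n(g) = Σ_{N𝔞 = n, (𝔞,𝔣)=1} ψ̃(𝔞)`.  The hypotheses of `isNewform0_of_functionalEquation_conj` are met: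
* (packet) `T_p g = a_p(g) g` for `p ∤ N` (`heckeT_eq_smul_of_cm_qExpansion` on the `Γ₁`-lift, `heckeT_liftToGamma1`), and `a_p(g)` is
  the packet of a newform `h ∈ S_k(Γ₀(M))`, `M ∣ N` (`exists_isNewform1_of_cm_qExpansion` — Atkin–Lehner–Li — and the descent
  `BCDT.exists_isNewform0_coe_eq_of_nebentypus_eq_one`), exactly as in the tree's proof of Ribet's Cor. (3.5)
  (`ribet1977_cmNewform_gamma0_of_heckeThetaCuspForm`);
* (multiplicativity) `a_{mn} = a_m a_n` for `(m,n) = 1` (unique factorisation of ideals, `finsum_absNorm_eq_mul_of_coprime`);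
* (level primes) for `ℓ ∣ N` at most ONE prime `𝔭` of `K` above `ℓ` is prime to `𝔣`, and it has degree one: `a_{ℓ^j} = ψ(𝔭)^j`
  (or `0`), `‖ψ(𝔭)‖² = ℓ^{k−1}` (`HasInfinityType.norm_valueAtUniformizer_sq` for the Hecke character `heckeOfGross` of `ψ`);
* (functional equation) `L(g, s) = L(ψ, s) = L(χ, s)` for the idelic `χ = heckeOfGross ψ` (`heckeLFunction_hasSum_rayClassCoeff_of_norm_eq_rpow`,
  the primes of `𝔣` being EXACTLY the ramified places of `χ` by primitivity, `IsGrossencharakter.le_asIdeal_iff_of_primitive`), whose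
  conductor is `𝔣` (`IsGrossencharakter.conductor_eq_of_primitive`); Hecke's functional equation with conductor `|d_K|·N𝔣 = N` is
  `Λ_N(g, s) = W·Λ_N(g^ρ, k − s)` with `g^ρ = Σ ā_n qⁿ` (`epsConj0 g`; `heckeLFunctionConj χ` is its `L`-series).  The infinity type is
  `(k−1, 0)` or `(0, k−1)` according as Mathlib's embedding of the infinite place of `K` is `σ` or `σ̄`; in the second case the fact
  is applied to `χ̄` (`HeckeCharacter.conjugate`, same conductor: `HeckeCharacter.conductor_conjugate`).

Also here: `Hecke_functionalEquation_infinityType_of_conductor` — the pinned fact implies the tree's existential-`B` fact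
`Hecke_functionalEquation_infinityType` (`B = √(d_K·N𝔣_χ)/(2π)`).

HONESTY. The Shimura fact is NOT discharged unconditionally: it is reduced to `Hecke_functionalEquation_infinityType_conductor` (Hecke's theta
integral / Tate's thesis for characters of infinite order, not in the tree).  No summit statement is proved by this file.

## References
* [Shimura1972ClassFieldsRealQuadratic] G. Shimura, Ann. of Math. 95 (1972), p. 138; [Shimura1971CMFactorsJacobians] Nagoya Math. J. 43 (1971), Lemma 3.
* [Ribet1977Nebentypus] K. A. Ribet, LNM 601 (1977), §3 Cor. (3.5), Remark (3.5).
* [Miyake2006] T. Miyake, *Modular Forms*, Thm. 4.6.17, Thm. 4.8.2.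
* [Li1975] W.-C. W. Li, Math. Ann. 212 (1975), Thm. 9.
* [deShalit1987] E. de Shalit, II §1.1 (1)–(3); [NeukirchANT1999] VII §6 (6.11), (8.5)–(8.6).
-/

noncomputable section

open scoped NumberField ModularForm MatrixGroups ComplexConjugate
open NumberField IsDedekindDomain CongruenceSubgroup Complex Finset
open UpperHalfPlane hiding I
open Literature.NumberTheory.GaloisRepresentations Literature.NumberTheory.LFunctions Literature.NumberTheory.Automorphic

/-! ## §0. The pinned functional equation implies the existential-`B` one -/

namespace Literature.NumberTheory.EllipticCurves

/-- `A^{s/2}·(2π)^{−s} = B^s` with `B = √A/(2π)` for a natural `A > 0` (all powers principal). [folklore] -/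
private theorem natCast_cpow_half_mul_two_pi_cpow_neg {A : ℕ} (hA : 0 < A) (s : ℂ) :
    ((A : ℂ)) ^ (s / 2) * (2 * Real.pi : ℂ) ^ (-s) = ((Real.sqrt A / (2 * Real.pi) : ℝ) : ℂ) ^ s := by
  have hA' : (0 : ℝ) < (A : ℝ) := by exact_mod_cast hA
  have hπ : (0 : ℝ) < 2 * Real.pi := by positivity
  have hsq : 0 < Real.sqrt (A : ℝ) := Real.sqrt_pos.mpr hA'
  have hB : 0 < Real.sqrt (A : ℝ) / (2 * Real.pi) := div_pos hsq hπ
  have hAc : (A : ℂ) ≠ 0 := by exact_mod_cast hA.ne'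
  have hπc : (2 * Real.pi : ℂ) ≠ 0 := by exact_mod_cast hπ.ne'
  have hBc : ((Real.sqrt A / (2 * Real.pi) : ℝ) : ℂ) ≠ 0 := by exact_mod_cast hB.ne'
  rw [Complex.cpow_def_of_ne_zero hAc, Complex.cpow_def_of_ne_zero hπc, Complex.cpow_def_of_ne_zero hBc,
    ← Complex.exp_add]
  congr 1
  have hlogA : Complex.log (A : ℂ) = (Real.log (A : ℝ) : ℂ) := by
    rw [show ((A : ℂ)) = ((A : ℝ) : ℂ) by push_cast; rfl, Complex.ofReal_log hA'.le]
  have hlogπ : Complex.log (2 * Real.pi : ℂ) = (Real.log (2 * Real.pi) : ℂ) := by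
    rw [show (2 * Real.pi : ℂ) = ((2 * Real.pi : ℝ) : ℂ) by push_cast; rfl, Complex.ofReal_log hπ.le]
  have hlogB : Complex.log ((Real.sqrt A / (2 * Real.pi) : ℝ) : ℂ) =
      ((Real.log (A : ℝ) / 2 - Real.log (2 * Real.pi) : ℝ) : ℂ) := by
    rw [← Complex.ofReal_log hB.le, Real.log_div hsq.ne' hπ.ne', Real.log_sqrt hA'.le]
  rw [hlogA, hlogπ, hlogB]
  push_cast
  ring

/-- **The pinned fact implies `Hecke_functionalEquation_infinityType`** (the tree's existential-`B` form of the same printed theorem):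
take `B = √(d_K·N𝔣_χ)/(2π) > 0` and the same `W`, `Λ`, `Λ'`. [cite: deShalit1987, II.1.1 (1)–(3)] -/
theorem Hecke_functionalEquation_infinityType_of_conductor (h : Hecke_functionalEquation_infinityType_conductor) :
    Hecke_functionalEquation_infinityType := by
  intro K _ _ hK χ m hm hχ
  obtain ⟨W, Λ, Λ', hW, hΛ, hΛ', hagree, hFE⟩ := h K hK χ m hm hχ
  set A : ℕ := (discr K).natAbs * Ideal.absNorm (HeckeCharacter.conductor χ) with hA_def
  have hA : 0 < A := by
    refine Nat.pos_of_ne_zero (mul_ne_zero (Int.natAbs_ne_zero.mpr (NumberField.discr_ne_zero K)) ?_)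
    rw [Ne, Ideal.absNorm_eq_zero_iff]
    exact HeckeCharacter.conductor_ne_bot χ
  refine ⟨Real.sqrt A / (2 * Real.pi), W, Λ, Λ', div_pos (Real.sqrt_pos.mpr (by exact_mod_cast hA)) (by positivity),
    hW, hΛ, hΛ', fun s hs ↦ ?_, hFE⟩
  obtain ⟨h1, h2⟩ := hagree s hs
  refine ⟨?_, ?_⟩
  · rw [h1, ← natCast_cpow_half_mul_two_pi_cpow_neg hA s]; ring
  · rw [h2, ← natCast_cpow_half_mul_two_pi_cpow_neg hA s]; ring

end Literature.NumberTheory.EllipticCurves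

namespace Literature.NumberTheory.EllipticCurves.ModularForms

variable {K : Type} [Field K] [NumberField K]

/-! ## §1. Arithmetic of the theta coefficients `a_n = Σ_{N𝔞 = n} rayClassCoeff 𝔣 ψ 𝔞` -/

section ThetaCoeff

variable (𝔣 : Ideal (𝓞 K)) (ψ : HeightOneSpectrum (𝓞 K) → ℂ)

/-- `a_1 = 1` (only the unit ideal has norm `1`). [folklore] -/
private theorem thetaCoeff_one : ∑ᶠ J ∈ {J : Ideal (𝓞 K) | Ideal.absNorm J = 1}, rayClassCoeff 𝔣 ψ J = 1 := by
  rw [finsum_absNorm_eq_one, rayClassCoeff_top]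

/-- `a_0 = 0` (only the zero ideal has norm `0`). [folklore] -/
private theorem thetaCoeff_zero : ∑ᶠ J ∈ {J : Ideal (𝓞 K) | Ideal.absNorm J = 0}, rayClassCoeff 𝔣 ψ J = 0 := by
  have h : {J : Ideal (𝓞 K) | Ideal.absNorm J = 0} = {⊥} := by
    ext J; simp [Ideal.absNorm_eq_zero_iff]
  rw [h, finsum_mem_singleton, rayClassCoeff_bot]

/-- **Multiplicativity**: `a_{mn} = a_m a_n` for coprime `m, n` (unique factorisation of ideals, `rayClassCoeff` multiplicative).
[cite: Ribet1977Nebentypus, §3 Thm. (3.4) (LNM 601, p. 35)] -/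
private theorem thetaCoeff_mul_of_coprime {m n : ℕ} (hmn : m.Coprime n) :
    ∑ᶠ J ∈ {J : Ideal (𝓞 K) | Ideal.absNorm J = m * n}, rayClassCoeff 𝔣 ψ J =
      (∑ᶠ J ∈ {J : Ideal (𝓞 K) | Ideal.absNorm J = m}, rayClassCoeff 𝔣 ψ J) *
        ∑ᶠ J ∈ {J : Ideal (𝓞 K) | Ideal.absNorm J = n}, rayClassCoeff 𝔣 ψ J := by
  rcases Nat.eq_zero_or_pos m with rfl | hm
  · have hn : n = 1 := by simpa using hmn
    subst hn
    rw [zero_mul, thetaCoeff_zero, zero_mul]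
  rcases Nat.eq_zero_or_pos n with rfl | hn
  · have hm1 : m = 1 := by simpa using hmn
    subst hm1
    rw [mul_zero, thetaCoeff_zero, mul_zero]
  exact finsum_absNorm_eq_mul_of_coprime _
    (map_mul_of_coprime_absNorm _ (fun A B hA hB ↦ rayClassCoeff_mul_of_ne_bot 𝔣 ψ hA hB) (rayClassCoeff_top 𝔣 ψ)) hm hn hmn

/-- For a prime `w` of `K`: `IsCoprime 𝔭_w 𝔣 ↔ 𝔣 ≰ 𝔭_w`. [folklore] -/
private theorem isCoprime_asIdeal_iff_not_le (w : HeightOneSpectrum (𝓞 K)) : IsCoprime w.asIdeal 𝔣 ↔ ¬ 𝔣 ≤ w.asIdeal := by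
  rw [Ideal.isCoprime_iff_sup_eq]
  constructor
  · intro h hle
    exact w.isPrime.ne_top (le_antisymm le_top (h ▸ sup_le le_rfl hle))
  · intro h
    by_contra hne
    exact h ((w.isMaximal.eq_of_le hne le_sup_left) ▸ le_sup_right)

/-- `rayClassCoeff 𝔣 ψ 𝔭_w = 0` at a prime `w ⊇ 𝔣`. [folklore] -/
private theorem rayClassCoeff_asIdeal_of_le {w : HeightOneSpectrum (𝓞 K)} (hw : 𝔣 ≤ w.asIdeal) :
    rayClassCoeff 𝔣 ψ w.asIdeal = 0 := by
  classical
  have hnc : ¬ IsCoprime w.asIdeal 𝔣 := fun h ↦ (isCoprime_asIdeal_iff_not_le 𝔣 w).mp h hw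
  simp [rayClassCoeff, hnc]

/-- A rational prime dividing `N I` (`I ≠ 0`) divides `N𝔭` for some prime `𝔭 ⊇ I`. [folklore] -/
private theorem exists_prime_le_of_prime_dvd_absNorm {I : Ideal (𝓞 K)} (hI : I ≠ ⊥) {ℓ : ℕ} (hℓ : ℓ.Prime)
    (h : ℓ ∣ Ideal.absNorm I) : ∃ w : HeightOneSpectrum (𝓞 K), I ≤ w.asIdeal ∧ ℓ ∣ Ideal.absNorm w.asIdeal := by
  classical
  have hN : Ideal.absNorm I = ((UniqueFactorizationMonoid.normalizedFactors I).map Ideal.absNorm).prod := by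
    rw [← map_multiset_prod, Ideal.prod_normalizedFactors_eq_self hI]
  rw [hN] at h
  obtain ⟨P, hP, hℓP⟩ := Prime.exists_mem_multiset_map_dvd (Nat.prime_iff.mp hℓ)
    (s := UniqueFactorizationMonoid.normalizedFactors I) (f := fun P => Ideal.absNorm P) h
  have hPp : Prime P := UniqueFactorizationMonoid.prime_of_normalized_factor P hP
  exact ⟨⟨P, Ideal.isPrime_of_prime hPp, hPp.ne_zero⟩,
    Ideal.le_of_dvd (UniqueFactorizationMonoid.dvd_of_mem_normalizedFactors hP), hℓP⟩

/-- A prime `𝔭` with `ℓ ∣ N𝔭` contains `ℓ`. [folklore] -/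
private theorem natCast_mem_of_dvd_absNorm {ℓ : ℕ} (hℓ : ℓ.Prime) (v : HeightOneSpectrum (𝓞 K))
    (h : ℓ ∣ Ideal.absNorm v.asIdeal) : (ℓ : 𝓞 K) ∈ v.asIdeal := by
  haveI := v.isMaximal
  haveI : Finite (𝓞 K ⧸ v.asIdeal) := Ideal.finiteQuotientOfFreeOfNeBot v.asIdeal v.ne_bot
  letI : Field (𝓞 K ⧸ v.asIdeal) := Ideal.Quotient.field v.asIdeal
  obtain ⟨q, hqchar⟩ := CharP.exists (𝓞 K ⧸ v.asIdeal)
  have hq : q.Prime := CharP.char_is_prime (𝓞 K ⧸ v.asIdeal) q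
  have hqv : (q : 𝓞 K) ∈ v.asIdeal := by
    rw [← Ideal.Quotient.eq_zero_iff_mem, map_natCast]
    exact CharP.cast_eq_zero (𝓞 K ⧸ v.asIdeal) q
  have hqZ : Prime (q : ℤ) := Nat.prime_iff_prime_int.mp hq
  have hunder : v.asIdeal.under ℤ = Ideal.span {(q : ℤ)} := by
    haveI hmax : (Ideal.span {(q : ℤ)}).IsMaximal :=
      ((Ideal.span_singleton_prime hqZ.ne_zero).mpr hqZ).isMaximal (by simpa using hqZ.ne_zero)
    refine (hmax.eq_of_le (Ideal.IsPrime.under ℤ v.asIdeal).ne_top ?_).symm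
    rw [Ideal.span_singleton_le_iff_mem, Ideal.under_def, Ideal.mem_comap, map_natCast]
    exact hqv
  haveI : v.asIdeal.LiesOver (Ideal.span {(q : ℤ)}) := ⟨hunder.symm⟩
  have hnorm := Ideal.absNorm_eq_pow_inertiaDeg' v.asIdeal hq
  rw [hnorm] at h
  have hℓq : ℓ = q := (Nat.prime_dvd_prime_iff_eq hℓ hq).mp (hℓ.dvd_of_dvd_pow h)
  subst hℓq
  exact hqv

/-- **The theta coefficients at a prime `ℓ ∣ |d_K|·N𝔣` are geometric**: for `K` quadratic and a prime `ℓ` dividing `|d_K|·N𝔣`, at most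
one prime of `K` above `ℓ` is prime to `𝔣`, and it has degree one; hence `a_{ℓ^j} = b^j` with `b = ψ(𝔭)` for a degree-one prime
`𝔭 ∤ 𝔣` above `ℓ`, or `b = 0`.  (Ramified `ℓ`: the unique prime above `ℓ`; split `ℓ = 𝔭𝔭̄` with `𝔭 ∣ 𝔣`: the ideals of norm `ℓ^j`
prime to `𝔣` are the `𝔭̄^j`; inert `ℓ` with `(ℓ) ∣ 𝔣`: none.) [cite: Miyake2006, Thm. 4.8.2 (the Euler factors of L(s, λ) at the level)] -/
private theorem thetaCoeff_prime_pow_of_dvd_level (hK2 : Module.finrank ℚ K = 2) (h𝔣 : 𝔣 ≠ ⊥) {ℓ : ℕ} (hℓ : ℓ.Prime)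
    (hℓN : ℓ ∣ (discr K).natAbs * Ideal.absNorm 𝔣) :
    ∃ b : ℂ, (∀ j : ℕ, ∑ᶠ J ∈ {J : Ideal (𝓞 K) | Ideal.absNorm J = ℓ ^ j}, rayClassCoeff 𝔣 ψ J = b ^ j) ∧
      (b = 0 ∨ ∃ w : HeightOneSpectrum (𝓞 K), ¬ 𝔣 ≤ w.asIdeal ∧ Ideal.absNorm w.asIdeal = ℓ ∧ b = ψ w) := by
  classical
  haveI : Fact ℓ.Prime := ⟨hℓ⟩
  -- the place `v` of `ℚ` under `ℓ`
  obtain ⟨v, hv⟩ : ∃ v : HeightOneSpectrum (𝓞 ℚ), Rat.HeightOneSpectrum.natGenerator v = ℓ :=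
    ⟨(Rat.HeightOneSpectrum.primesEquiv (R := 𝓞 ℚ)).symm ⟨ℓ, hℓ⟩,
      congrArg Subtype.val ((Rat.HeightOneSpectrum.primesEquiv (R := 𝓞 ℚ)).apply_symm_apply _)⟩
  subst hv
  set ℓ := Rat.HeightOneSpectrum.natGenerator v with hℓdef
  -- multiplicativity data for the tree's prime-power lemmas
  have hg : ∀ A B : Ideal (𝓞 K), A ≠ ⊥ → B ≠ ⊥ → rayClassCoeff 𝔣 ψ (A * B) = rayClassCoeff 𝔣 ψ A * rayClassCoeff 𝔣 ψ B :=
    fun A B hA hB ↦ rayClassCoeff_mul_of_ne_bot 𝔣 ψ hA hB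
  have hg1 : rayClassCoeff 𝔣 ψ ⊤ = 1 := rayClassCoeff_top 𝔣 ψ
  -- the value `b = rayClassCoeff 𝔣 ψ 𝔭_w` at a prime `w` of norm `ℓ` is `ψ w` or `0`
  have hb : ∀ w : HeightOneSpectrum (𝓞 K), Ideal.absNorm w.asIdeal = ℓ →
      rayClassCoeff 𝔣 ψ w.asIdeal = 0 ∨
        ∃ w' : HeightOneSpectrum (𝓞 K), ¬ 𝔣 ≤ w'.asIdeal ∧ Ideal.absNorm w'.asIdeal = ℓ ∧ rayClassCoeff 𝔣 ψ w.asIdeal = ψ w' := by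
    intro w hw
    by_cases hle : 𝔣 ≤ w.asIdeal
    · exact Or.inl (rayClassCoeff_asIdeal_of_le 𝔣 ψ hle)
    · exact Or.inr ⟨w, hle, hw, rayClassCoeff_asIdeal_of_isCoprime 𝔣 ψ ((isCoprime_asIdeal_iff_not_le 𝔣 w).mpr hle)⟩
  -- a prime of `𝔣` above `ℓ`, when `ℓ ∣ N𝔣`
  have hdiv : ℓ ∣ Ideal.absNorm 𝔣 → ∃ u : HeightOneSpectrum (𝓞 K), 𝔣 ≤ u.asIdeal ∧ u.asIdeal.under (𝓞 ℚ) = v.asIdeal := by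
    intro h
    obtain ⟨u, hu, hℓu⟩ := exists_prime_le_of_prime_dvd_absNorm h𝔣 hℓ h
    exact ⟨u, hu, (asIdeal_under_eq_iff_natCast_mem v u).mpr (natCast_mem_of_dvd_absNorm hℓ u hℓu)⟩
  by_cases hD : (ℓ : ℤ) ∣ discr K
  · -- ramified: the unique prime `w ∋ ℓ`, `N w = ℓ`, and `{N I = ℓ^j} = {w^j}`
    have hℓZ : Prime (ℓ : ℤ) := Nat.prime_iff_prime_int.mp hℓ
    haveI : (Ideal.span {(ℓ : ℤ)}).IsPrime := (Ideal.span_singleton_prime hℓZ.ne_zero).mpr hℓZ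
    obtain ⟨Q, -, hQ, hQcomap⟩ := Ideal.exists_ideal_over_prime_of_isIntegral (S := 𝓞 K) (Ideal.span {(ℓ : ℤ)}) ⊥
      (by
        rw [← RingHom.ker_eq_comap_bot, (RingHom.injective_iff_ker_eq_bot _).mp (algebraMap ℤ (𝓞 K)).injective_int]
        exact bot_le)
    have hℓQ : (ℓ : 𝓞 K) ∈ Q := by
      have : (ℓ : ℤ) ∈ Q.comap (algebraMap ℤ (𝓞 K)) := by rw [hQcomap]; exact Ideal.mem_span_singleton_self _
      rw [Ideal.mem_comap, map_natCast] at this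
      exact this
    have hQ0 : Q ≠ ⊥ := by
      intro h0
      rw [h0, Ideal.mem_bot] at hℓQ
      exact hℓ.ne_zero (by exact_mod_cast hℓQ)
    set w : HeightOneSpectrum (𝓞 K) := ⟨Q, hQ, hQ0⟩ with hwdef
    have hℓw : ((ℓ : ℕ) : 𝓞 K) ∈ w.asIdeal := hℓQ
    have hS : {w' : HeightOneSpectrum (𝓞 K) | w'.asIdeal.under (𝓞 ℚ) = v.asIdeal} = {w} := by
      ext w'
      simp only [Set.mem_setOf_eq, Set.mem_singleton_iff]
      constructor
      · intro hw'
        have hmem := (asIdeal_under_eq_iff_natCast_mem v w').mp hw'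
        haveI := w'.isPrime
        exact HeightOneSpectrum.ext
          (DeuringCM.RamifiedSevenEllipticUnits.LemmaXi.eq_asIdeal_of_dvd_discr hK2 hD w hℓw hmem)
      · rintro rfl
        exact (asIdeal_under_eq_iff_natCast_mem v w).mpr hℓw
    have hNw : Ideal.absNorm w.asIdeal = ℓ := by
      have hset := DeuringCM.RamifiedSevenEllipticUnits.Rigidity.setOf_absNorm_eq_of_dvd_discr hK2 hD w hℓw
      have : w.asIdeal ∈ ({w.asIdeal} : Set (Ideal (𝓞 K))) := Set.mem_singleton _
      rw [← hset] at this
      exact this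
    have hpowset : ∀ j : ℕ, {I : Ideal (𝓞 K) | Ideal.absNorm I = ℓ ^ j} = {w.asIdeal ^ j} := by
      intro j
      ext I
      simp only [Set.mem_setOf_eq, Set.mem_singleton_iff]
      constructor
      · intro hI
        have hIeq := eq_pow_of_absNorm_eq_pow_of_singleton v hS hI
        set c := (Associates.mk w.asIdeal).count (Associates.mk I).factors
        have hc : c = j := by
          have h2 := congrArg Ideal.absNorm hIeq
          rw [hI, map_pow, hNw] at h2
          exact (Nat.pow_right_injective hℓ.two_le h2).symm
        rw [hIeq, hc]
      · rintro rfl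
        rw [map_pow, hNw]
    refine ⟨rayClassCoeff 𝔣 ψ w.asIdeal, fun j ↦ ?_, ?_⟩
    · rw [hpowset j, finsum_mem_singleton, map_pow_of_map_mul _ hg hg1 w.ne_bot]
    · rcases hb w hNw with h0 | ⟨w', hw', hNw', hval⟩
      · exact Or.inl h0
      · exact Or.inr ⟨w', hw', hNw', hval⟩
  · -- unramified: `ℓ ∣ N𝔣`, so some prime above `ℓ` divides `𝔣`
    have hℓ𝔣 : ℓ ∣ Ideal.absNorm 𝔣 := by
      rcases (Nat.Prime.dvd_mul hℓ).mp hℓN with h | h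
      · exact absurd (Int.ofNat_dvd_left.mpr h) hD
      · exact h
    obtain ⟨u, hu𝔣, huv⟩ := hdiv hℓ𝔣
    have he : v.asIdeal.ramificationIdxIn (𝓞 K) = 1 := ramificationIdxIn_eq_one_of_not_dvd_discr K v hD
    rcases exists_places_eq_pair_or_eq_singleton hK2 v he with ⟨w₁, w₂, hne, hS, h₁, h₂⟩ | ⟨w, hS, hw⟩
    · -- split: `u ∈ {w₁, w₂}` divides `𝔣`
      have hpow := fun j ↦ finsum_absNorm_eq_prime_pow_of_pair (rayClassCoeff 𝔣 ψ) hg hg1 v hne hS h₁ h₂ j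
      have hN₁ : Ideal.absNorm w₁.asIdeal = ℓ := by
        have hm : w₁.asIdeal ∈ ({w₁.asIdeal, w₂.asIdeal} : Set (Ideal (𝓞 K))) := Set.mem_insert _ _
        rw [← setOf_absNorm_eq_of_pair v hS h₁ h₂] at hm
        exact hm
      have hN₂ : Ideal.absNorm w₂.asIdeal = ℓ := by
        have hm : w₂.asIdeal ∈ ({w₁.asIdeal, w₂.asIdeal} : Set (Ideal (𝓞 K))) := Set.mem_insert_of_mem _ rfl
        rw [← setOf_absNorm_eq_of_pair v hS h₁ h₂] at hm
        exact hm
      have hu : u ∈ ({w₁, w₂} : Set (HeightOneSpectrum (𝓞 K))) := by rw [← hS]; exact huv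
      rcases hu with rfl | hu2
      · -- `w₁ ∣ 𝔣`: `a_{ℓ^j} = r₂^j`
        have hr₁ : rayClassCoeff 𝔣 ψ u.asIdeal = 0 := rayClassCoeff_asIdeal_of_le 𝔣 ψ hu𝔣
        refine ⟨rayClassCoeff 𝔣 ψ w₂.asIdeal, fun j ↦ ?_, ?_⟩
        · rw [hpow j, Finset.sum_eq_single 0]
          · rw [pow_zero, one_mul, Nat.sub_zero]
          · intro i _ hi
            rw [hr₁, zero_pow hi, zero_mul]
          · intro h0; exact absurd (Finset.mem_range.mpr (Nat.succ_pos j)) h0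
        · rcases hb w₂ hN₂ with h0 | ⟨w', hw', hNw', hval⟩
          · exact Or.inl h0
          · exact Or.inr ⟨w', hw', hNw', hval⟩
      · rw [Set.mem_singleton_iff] at hu2
        subst hu2
        have hr₂ : rayClassCoeff 𝔣 ψ u.asIdeal = 0 := rayClassCoeff_asIdeal_of_le 𝔣 ψ hu𝔣
        refine ⟨rayClassCoeff 𝔣 ψ w₁.asIdeal, fun j ↦ ?_, ?_⟩
        · rw [hpow j, Finset.sum_eq_single j]
          · rw [Nat.sub_self, pow_zero, mul_one]
          · intro i hi hij
            have hlt : i < j := lt_of_le_of_ne (Nat.lt_succ_iff.mp (Finset.mem_range.mp hi)) hij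
            rw [hr₂, zero_pow (Nat.sub_ne_zero_of_lt hlt), mul_zero]
          · intro h0; exact absurd (Finset.mem_range.mpr (Nat.lt_succ_self j)) h0
        · rcases hb w₁ hN₁ with h0 | ⟨w', hw', hNw', hval⟩
          · exact Or.inl h0
          · exact Or.inr ⟨w', hw', hNw', hval⟩
    · -- inert: `u = w = (ℓ)` divides `𝔣`, all `a_{ℓ^j}` (`j ≥ 1`) vanish
      have hu : u ∈ ({w} : Set (HeightOneSpectrum (𝓞 K))) := by rw [← hS]; exact huv
      rw [Set.mem_singleton_iff] at hu
      subst hu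
      have hr : rayClassCoeff 𝔣 ψ u.asIdeal = 0 := rayClassCoeff_asIdeal_of_le 𝔣 ψ hu𝔣
      refine ⟨0, fun j ↦ ?_, Or.inl rfl⟩
      obtain ⟨a, rfl | rfl⟩ := Nat.even_or_odd' j
      · rw [(finsum_absNorm_eq_prime_pow_of_singleton (rayClassCoeff 𝔣 ψ) hg hg1 v hS hw a).1, hr]
        rcases Nat.eq_zero_or_pos a with rfl | ha
        · simp
        · rw [zero_pow ha.ne', zero_pow (by omega)]
      · rw [(finsum_absNorm_eq_prime_pow_of_singleton (rayClassCoeff 𝔣 ψ) hg hg1 v hS hw a).2, zero_pow (by omega)]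

end ThetaCoeff

/-! ## §2. The conductor of the conjugate Hecke character -/

/-- `χ̄_v` is trivial on `U_v^{(f)}` iff `χ_v` is (`\overline{z} = 1 ↔ z = 1`). [cite: deShalit1987, II.1.1 (3) (χ̄ has the conductor of χ)] -/
private theorem isTrivialOnHigherUnitsAt_conjugate_iff (χ : HeckeCharacter K) (v : HeightOneSpectrum (𝓞 K)) (f : ℕ) :
    χ.conjugate.IsTrivialOnHigherUnitsAt v f ↔ χ.IsTrivialOnHigherUnitsAt v f := by
  refine forall_congr' fun u ↦ imp_congr_right fun _ ↦ ?_
  rw [← Units.val_eq_one, HeckeCharacter.coe_localComponent_conjugate, map_eq_one_iff (starRingEnd ℂ) (RingHom.injective _),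
    Units.val_eq_one]

/-- `f(χ̄_v) = f(χ_v)`. [cite: deShalit1987, II.1.1 (3) (χ̄ has the conductor of χ)] -/
private theorem conductorExponentAt_conjugate (χ : HeckeCharacter K) (v : HeightOneSpectrum (𝓞 K)) :
    χ.conjugate.conductorExponentAt v = χ.conductorExponentAt v := by
  unfold HeckeCharacter.conductorExponentAt
  congr 1
  ext f
  exact isTrivialOnHigherUnitsAt_conjugate_iff χ v f

/-- **`𝔣(χ̄) = 𝔣(χ)`**: the complex-conjugate character has the same conductor (de Shalit II.1.1: "`χ̄` … `𝔣_χ`").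
[cite: deShalit1987, II.1.1 (3)] -/
theorem _root_.Literature.NumberTheory.GaloisRepresentations.HeckeCharacter.conductor_conjugate (χ : HeckeCharacter K) : χ.conjugate.conductor = χ.conductor := by
  rw [HeckeCharacter.conductor_def, HeckeCharacter.conductor_def]
  have hset : (HeckeCharacter.finite_ramifiedPlaces_holds χ.conjugate).toFinset =
      (HeckeCharacter.finite_ramifiedPlaces_holds χ).toFinset := by
    ext v
    rw [HeckeCharacter.mem_toFinset_ramifiedPlaces_iff, HeckeCharacter.mem_toFinset_ramifiedPlaces_iff,
      HeckeCharacter.isUnramifiedAt_conjugate_iff]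
  rw [hset]
  exact Finset.prod_congr rfl fun v _ ↦ by rw [conductorExponentAt_conjugate χ v]

/-! ## §3. The unique infinite place of an imaginary quadratic field -/

/-- In an imaginary quadratic field every infinite place `v` is complex (`mult v = 2`) and, for any embedding `σ`,
`embType σ v + embTypeConj σ v = 1` (the place of `σ` is the only one, and its embedding is `σ` or `σ̄`). [folklore] -/
private theorem embType_add_embTypeConj_eq_one (hK2 : Module.finrank ℚ K = 2) [IsTotallyComplex K] (σ : K →+* ℂ)
    (v : InfinitePlace K) : embType σ v + embTypeConj σ v = 1 ∧ (v.mult : ℤ) = 2 := by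
  classical
  have hr : InfinitePlace.nrRealPlaces K = 0 := NumberField.nrRealPlaces_eq_zero_iff.mpr inferInstance
  have hc : InfinitePlace.nrComplexPlaces K = 1 := by
    have h := InfinitePlace.card_add_two_mul_card_eq_rank K
    rw [hK2, hr] at h
    omega
  have hcard : Fintype.card (InfinitePlace K) = 1 := by
    rw [InfinitePlace.card_eq_nrRealPlaces_add_nrComplexPlaces, hr, hc]
  have hv : v = InfinitePlace.mk σ := Fintype.card_le_one_iff.mp hcard.le v (InfinitePlace.mk σ)
  have hemb : v.embedding = σ ∨ ComplexEmbedding.conjugate v.embedding = σ := by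
    rw [← InfinitePlace.mk_eq_iff, InfinitePlace.mk_embedding, hv]
  refine ⟨?_, ?_⟩
  · unfold embType embTypeConj
    rcases hemb with h | h
    · simp [h]
    · by_cases h' : v.embedding = σ
      · simp [h']
      · simp [h', h]
  · rw [InfinitePlace.mult, if_neg (InfinitePlace.not_isReal_iff_isComplex.mpr (IsTotallyComplex.isComplex v))]
    norm_num

/-- An imaginary quadratic field has ONE infinite place. [folklore] -/
private theorem infinitePlace_eq (hK2 : Module.finrank ℚ K = 2) [IsTotallyComplex K] (v w : InfinitePlace K) : v = w := by
  have hr : InfinitePlace.nrRealPlaces K = 0 := NumberField.nrRealPlaces_eq_zero_iff.mpr inferInstance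
  have hc : InfinitePlace.nrComplexPlaces K = 1 := by
    have h := InfinitePlace.card_add_two_mul_card_eq_rank K
    rw [hK2, hr] at h
    omega
  have hcard : Fintype.card (InfinitePlace K) = 1 := by
    rw [InfinitePlace.card_eq_nrRealPlaces_add_nrComplexPlaces, hr, hc]
  exact Fintype.card_le_one_iff.mp hcard.le v w

/-- The weight identity `2·(p_v + q_v) = (k−1)·mult v` for the type `((k−1)·embType σ, (k−1)·embTypeConj σ)` of an imaginary
quadratic field. [folklore] -/
private theorem two_mul_type_eq (hK2 : Module.finrank ℚ K = 2) [IsTotallyComplex K] (σ : K →+* ℂ) (m : ℤ) (v : InfinitePlace K) :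
    2 * ((fun w ↦ m * embType σ w) v + (fun w ↦ m * embTypeConj σ w) v) = m * (v.mult : ℤ) := by
  obtain ⟨h1, h2⟩ := embType_add_embTypeConj_eq_one hK2 σ v
  simp only
  rw [← mul_add, h1, h2]
  ring

/-! ## §4. `‖ψ(𝔭)‖² = N𝔭^{k−1}` and `L(θ_ψ, s) = L(χ, s)` for the Hecke character `χ` of `ψ` -/

section Bridge

variable {𝔣 : Ideal (𝓞 K)} {ψ : HeightOneSpectrum (𝓞 K) → ℂ} {σ : K →+* ℂ} {k : ℕ}

/-- **`‖ψ(𝔭)‖² = N𝔭^{k−1}`** at a prime `𝔭 ∤ 𝔣`, for a Größencharakter `ψ mod 𝔣` of type `σ^{k−1}` of an imaginary quadratic field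
(purity of the algebraic Hecke character `heckeOfGross ψ`, `HasInfinityType.norm_valueAtUniformizer_sq`; Weil 1956).
[cite: Ribet1977Nebentypus, §3 (|ψ(𝔞)| = N𝔞^{(k−1)/2})] -/
theorem norm_apply_sq_of_isGrossencharakter_weight (hK2 : Module.finrank ℚ K = 2) [IsTotallyComplex K] (h𝔣 : 𝔣 ≠ ⊥)
    (hψG : IsGrossencharakter 𝔣 (fun w => ((k : ℤ) - 1) * embType σ w) (fun w => ((k : ℤ) - 1) * embTypeConj σ w) ψ)
    {w : HeightOneSpectrum (𝓞 K)} (hw : ¬ 𝔣 ≤ w.asIdeal) :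
    ‖ψ w‖ ^ 2 = ((Ideal.absNorm w.asIdeal : ℕ) : ℝ) ^ ((k : ℤ) - 1) := by
  have hinf := heckeOfGross_hasInfinityType h𝔣 hψG
  have hmod := HeckeCharacter.isModulus_conductorExponentAt (heckeOfGross h𝔣 hψG)
  have hwT : w ∉ (HeckeCharacter.finite_ramifiedPlaces_holds (heckeOfGross h𝔣 hψG)).toFinset := by
    rw [HeckeCharacter.mem_toFinset_ramifiedPlaces_iff, not_not]
    exact heckeOfGross_isUnramifiedAt h𝔣 hψG hw
  have h := hinf.norm_valueAtUniformizer_sq hmod (wt := (k : ℤ) - 1) (fun v ↦ two_mul_type_eq hK2 σ _ v) hwT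
  rwa [heckeOfGross_valueAtUniformizer h𝔣 hψG hw] at h

/-- A prime of `K` NOT dividing `𝔣` exists (a prime above any rational prime `ℓ > N𝔣`). [folklore] -/
private theorem exists_not_le_asIdeal (h𝔣 : 𝔣 ≠ ⊥) : ∃ w : HeightOneSpectrum (𝓞 K), ¬ 𝔣 ≤ w.asIdeal := by
  classical
  obtain ⟨ℓ, hℓN, hℓ⟩ := Nat.exists_infinite_primes (Ideal.absNorm 𝔣 + 1)
  have hℓZ : Prime (ℓ : ℤ) := Nat.prime_iff_prime_int.mp hℓ
  haveI : (Ideal.span {(ℓ : ℤ)}).IsPrime := (Ideal.span_singleton_prime hℓZ.ne_zero).mpr hℓZ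
  obtain ⟨Q, -, hQ, hQcomap⟩ := Ideal.exists_ideal_over_prime_of_isIntegral (S := 𝓞 K) (Ideal.span {(ℓ : ℤ)}) ⊥
    (by
      rw [← RingHom.ker_eq_comap_bot, (RingHom.injective_iff_ker_eq_bot _).mp (algebraMap ℤ (𝓞 K)).injective_int]
      exact bot_le)
  have hℓQ : (ℓ : 𝓞 K) ∈ Q := by
    have : (ℓ : ℤ) ∈ Q.comap (algebraMap ℤ (𝓞 K)) := by rw [hQcomap]; exact Ideal.mem_span_singleton_self _
    rw [Ideal.mem_comap, map_natCast] at this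
    exact this
  have hQ0 : Q ≠ ⊥ := by
    intro h0
    rw [h0, Ideal.mem_bot] at hℓQ
    exact hℓ.ne_zero (by exact_mod_cast hℓQ)
  refine ⟨⟨Q, hQ, hQ0⟩, fun hle ↦ ?_⟩
  -- `N𝔭 ∣ N𝔣` and `ℓ ∣ N𝔭`, so `ℓ ≤ N𝔣`
  have hdvd : Ideal.absNorm Q ∣ Ideal.absNorm 𝔣 := Ideal.absNorm_dvd_absNorm_of_le hle
  have hℓdvd : ℓ ∣ Ideal.absNorm Q := by
    have h1 : Ideal.absNorm Q ∣ Ideal.absNorm (Ideal.span {(ℓ : 𝓞 K)}) :=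
      Ideal.absNorm_dvd_absNorm_of_le ((Ideal.span_singleton_le_iff_mem _).mpr hℓQ)
    rw [Ideal.absNorm_span_singleton, ← map_natCast (algebraMap ℤ (𝓞 K)) ℓ, Algebra.norm_algebraMap, Int.natAbs_pow,
      Int.natAbs_natCast] at h1
    have hQ1 : Ideal.absNorm Q ≠ 1 := by
      rw [Ne, Ideal.absNorm_eq_one_iff]; exact hQ.ne_top
    obtain ⟨i, -, hi⟩ := (Nat.dvd_prime_pow hℓ).mp h1
    rw [hi] at hQ1 ⊢
    rcases Nat.eq_zero_or_pos i with rfl | hi0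
    · exact absurd (pow_zero ℓ) hQ1
    · exact dvd_pow_self ℓ hi0.ne'
  have hN0 : Ideal.absNorm 𝔣 ≠ 0 := by rw [Ne, Ideal.absNorm_eq_zero_iff]; exact h𝔣
  have := Nat.le_of_dvd (Nat.pos_of_ne_zero hN0) (hℓdvd.trans hdvd)
  omega

/-- **`L(θ_ψ, s) = L(χ, s)`** on `re s > (k+1)/2`: the Dirichlet series `Σ_n (Σ_{N𝔞 = n,(𝔞,𝔣)=1} ψ̃(𝔞)) n^{−s}` of the theta coefficients
is the Euler product of the idelic Hecke character `χ = heckeOfGross ψ` over its unramified places — for PRIMITIVE `ψ` the primes of `𝔣`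
are exactly the ramified places (`IsGrossencharakter.le_asIdeal_iff_of_primitive`) and `χ(ϖ_𝔭) = ψ(𝔭)` off `𝔣`; the exponent of `χ` is
`−(k−1)/2` (`norm_apply_eq_ideleNorm_rpow_of_hasInfinityType`), so the tree's `heckeLFunction_hasSum_rayClassCoeff_of_norm_eq_rpow`
applies on `re s > 1 + (k−1)/2`, and the sum over ideals is regrouped by the norm. [cite: NeukirchANT1999, Ch. VII §8 (8.1) Proposition] -/
theorem LSeries_thetaCoeff_eq_heckeLFunction (hK2 : Module.finrank ℚ K = 2) [IsTotallyComplex K] (h𝔣 : 𝔣 ≠ ⊥)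
    (hψG : IsGrossencharakter 𝔣 (fun w => ((k : ℤ) - 1) * embType σ w) (fun w => ((k : ℤ) - 1) * embTypeConj σ w) ψ)
    (hprim : ∀ (𝔣₁ : Ideal (𝓞 K)) (ψ₁ : HeightOneSpectrum (𝓞 K) → ℂ), 𝔣 ≤ 𝔣₁ →
      (∀ v : HeightOneSpectrum (𝓞 K), ¬ 𝔣 ≤ v.asIdeal → ψ₁ v = ψ v) →
      IsGrossencharakter 𝔣₁ (fun w => ((k : ℤ) - 1) * embType σ w) (fun w => ((k : ℤ) - 1) * embTypeConj σ w) ψ₁ → 𝔣₁ = 𝔣)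
    {s : ℂ} (hs : ((k : ℝ) + 1) / 2 < s.re) :
    LSeries (fun n ↦ ∑ᶠ J ∈ {J : Ideal (𝓞 K) | Ideal.absNorm J = n}, rayClassCoeff 𝔣 ψ J) s =
      heckeLFunction (heckeOfGross h𝔣 hψG) s := by
  classical
  set χ := heckeOfGross h𝔣 hψG with hχdef
  have hinf := heckeOfGross_hasInfinityType h𝔣 hψG
  have hmod := HeckeCharacter.isModulus_conductorExponentAt χ
  obtain ⟨v₀, hv₀⟩ := exists_not_le_asIdeal h𝔣
  have hv₀T : v₀ ∉ (HeckeCharacter.finite_ramifiedPlaces_holds χ).toFinset := by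
    rw [HeckeCharacter.mem_toFinset_ramifiedPlaces_iff, not_not]
    exact heckeOfGross_isUnramifiedAt h𝔣 hψG hv₀
  have hσ := HeckeCharacter.norm_apply_eq_ideleNorm_rpow_of_hasInfinityType hinf hmod (wt := (k : ℤ) - 1)
    (fun v ↦ two_mul_type_eq hK2 σ _ v) hv₀T
  have hiff : ∀ v : HeightOneSpectrum (𝓞 K), χ.IsUnramifiedAt v ↔ ¬ 𝔣 ≤ v.asIdeal := by
    intro v
    have := hψG.le_asIdeal_iff_of_primitive h𝔣 hprim v
    tauto
  have hs' : 1 - (-(((k : ℤ) - 1 : ℤ) : ℝ) / 2) < s.re := by push_cast; linarith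
  have hsum := HeckeCharacter.heckeLFunction_hasSum_rayClassCoeff_of_norm_eq_rpow hσ h𝔣 hiff hs'
  -- the coefficients only see `ψ` off `𝔣`
  have hcoeff : (fun I : Ideal (𝓞 K) ↦ rayClassCoeff 𝔣 (fun v ↦ χ.valueAtUniformizer v) I * ((Ideal.absNorm I : ℕ) : ℂ) ^ (-s)) =
      fun I ↦ rayClassCoeff 𝔣 ψ I * ((Ideal.absNorm I : ℕ) : ℂ) ^ (-s) := by
    funext I
    rw [rayClassCoeff_congr h𝔣 (fun v hv ↦ heckeOfGross_valueAtUniformizer h𝔣 hψG hv) I]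
  rw [hcoeff] at hsum
  -- regroup the sum over ideals by the norm
  set f : Ideal (𝓞 K) → ℂ := fun I ↦ rayClassCoeff 𝔣 ψ I * ((Ideal.absNorm I : ℕ) : ℂ) ^ (-s) with hfdef
  have h1 := hsum.tsum_fiberwise (Ideal.absNorm : Ideal (𝓞 K) → ℕ)
  have h2 : ∀ n : ℕ, ∑' I : ↥((Ideal.absNorm : Ideal (𝓞 K) → ℕ) ⁻¹' {n}), f I =
      LSeries.term (fun n ↦ ∑ᶠ J ∈ {J : Ideal (𝓞 K) | Ideal.absNorm J = n}, rayClassCoeff 𝔣 ψ J) s n := by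
    intro n
    have hset : ((Ideal.absNorm : Ideal (𝓞 K) → ℕ) ⁻¹' {n}) = ↑(NumberField.idealsOfNorm K n) := by
      ext I; simp
    have hset' : {J : Ideal (𝓞 K) | Ideal.absNorm J = n} = ↑(NumberField.idealsOfNorm K n) := by
      ext I; simp
    rw [tsum_congr_set_coe f hset, Finset.tsum_subtype' (NumberField.idealsOfNorm K n) f, LSeries.term_def, hset',
      finsum_mem_coe_finset]
    split_ifs with hn
    · subst hn
      have : NumberField.idealsOfNorm K 0 = {⊥} := by
        ext I; simp [Ideal.absNorm_eq_zero_iff]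
      rw [this, Finset.sum_singleton, hfdef]
      dsimp only
      rw [rayClassCoeff_bot, zero_mul]
    · rw [Finset.sum_div]
      refine Finset.sum_congr rfl fun I hI ↦ ?_
      rw [NumberField.mem_idealsOfNorm] at hI
      rw [hfdef]
      dsimp only
      rw [hI, Complex.cpow_neg, div_eq_mul_inv]
  have h3 : HasSum (fun n : ℕ ↦ LSeries.term (fun n ↦ ∑ᶠ J ∈ {J : Ideal (𝓞 K) | Ideal.absNorm J = n}, rayClassCoeff 𝔣 ψ J) s n)
      (heckeLFunction χ s) := h1.congr_fun fun n ↦ (h2 n).symm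
  exact h3.tsum_eq

end Bridge

/-- `Σ conj(aₙ) n^{-s} = conj (Σ aₙ n^{-conj s})` (termwise; the tree's `LSeries_conj` of `Gamma1NewformFunctionalEquationProofs`, restated
to keep the imports light). [folklore] -/
private theorem LSeries_conj' (a : ℕ → ℂ) (s : ℂ) : LSeries (fun n ↦ conj (a n)) s = conj (LSeries a (conj s)) := by
  rw [LSeries, LSeries, Complex.conj_tsum]
  refine tsum_congr fun n ↦ ?_
  rcases Nat.eq_zero_or_pos n with rfl | hn
  · simp [LSeries.term_zero]
  · have harg : ((n : ℝ) : ℂ).arg ≠ Real.pi := by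
      rw [Complex.arg_ofReal_of_nonneg (Nat.cast_nonneg n)]
      exact Real.pi_ne_zero.symm
    have hc : conj (((n : ℝ) : ℂ) ^ conj s) = ((n : ℝ) : ℂ) ^ s := by
      have h := Complex.cpow_conj ((n : ℝ) : ℂ) (conj s) harg
      rw [Complex.conj_ofReal, Complex.conj_conj] at h
      rw [← h]
    rw [LSeries.term_of_ne_zero hn.ne', LSeries.term_of_ne_zero hn.ne', map_div₀, ← Complex.ofReal_natCast, hc]

/-! ## §5. The theorem -/

/-- **The theorem at a named level `N₀ = |d_K|·N𝔣`** (the fact's shape has the level as the literal product; this version with a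
level VARIABLE is the one proved, see `shimura1972_heckeTheta_isNewform0_of_primitive_of_heckeFE`). [cite: Ribet1977Nebentypus, §3 Remark (3.5) (LNM 601, p. 35)]
[cite: Miyake2006, Thm. 4.8.2] -/
theorem isNewform0_of_heckeTheta_primitive_of_heckeFE (hHecke : Hecke_functionalEquation_infinityType_conductor)
    (hK2 : Module.finrank ℚ K = 2) (htc : IsTotallyComplex K) (σ : K →+* ℂ) (k : ℕ) (hk : 2 ≤ k)
    (𝔣 : Ideal (𝓞 K)) (h𝔣 : 𝔣 ≠ ⊥) (ψ : HeightOneSpectrum (𝓞 K) → ℂ)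
    (hψG : IsGrossencharakter 𝔣 (fun w => ((k : ℤ) - 1) * embType σ w) (fun w => ((k : ℤ) - 1) * embTypeConj σ w) ψ)
    (hprim : ∀ (𝔣₁ : Ideal (𝓞 K)) (ψ₁ : HeightOneSpectrum (𝓞 K) → ℂ), 𝔣 ≤ 𝔣₁ →
      (∀ v : HeightOneSpectrum (𝓞 K), ¬ 𝔣 ≤ v.asIdeal → ψ₁ v = ψ v) →
      IsGrossencharakter 𝔣₁ (fun w => ((k : ℤ) - 1) * embType σ w) (fun w => ((k : ℤ) - 1) * embTypeConj σ w) ψ₁ → 𝔣₁ = 𝔣)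
    (hneb : ∀ n : ℕ, Odd n → n.Coprime ((discr K).natAbs * Ideal.absNorm 𝔣) →
      idealPow K ψ (Ideal.span {(n : 𝓞 K)}) = (jacobiSym (discr K) n : ℂ) * (n : ℂ) ^ (k - 1))
    {N₀ : ℕ} [NeZero N₀] (hN₀def : N₀ = (discr K).natAbs * Ideal.absNorm 𝔣) (g : CuspForm (Gamma0 N₀) (k : ℤ))
    (hcoeff : ∀ n : ℕ, 0 < n → cuspCoeff g n = ∑ᶠ J ∈ {J : Ideal (𝓞 K) | Ideal.absNorm J = n}, rayClassCoeff 𝔣 ψ J) :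
    IsNewform0 g := by
  classical
  haveI := htc
  haveI : NeZero (discr K).natAbs := ⟨Int.natAbs_ne_zero.mpr (NumberField.discr_ne_zero K)⟩
  have hM : Ideal.absNorm 𝔣 ≠ 0 := by rw [Ne, Ideal.absNorm_eq_zero_iff]; exact h𝔣
  have hk1 : 1 ≤ k := by omega
  have hzpow : ∀ x : ℂ, x ^ ((k : ℤ) - 1) = x ^ (k - 1) := fun x ↦ by
    rw [show ((k : ℤ) - 1) = ((k - 1 : ℕ) : ℤ) by omega, zpow_natCast]
  -- the theta coefficients `a`
  set a : ℕ → ℂ := fun n ↦ ∑ᶠ J ∈ {J : Ideal (𝓞 K) | Ideal.absNorm J = n}, rayClassCoeff 𝔣 ψ J with hadef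
  have hga : ∀ n : ℕ, cuspCoeff g n = a n := by
    intro n
    rcases Nat.eq_zero_or_pos n with rfl | hn
    · rw [cuspCoeff_zero_eq, hadef]
      exact (thetaCoeff_zero 𝔣 ψ).symm
    · exact hcoeff n hn
  -- ## Step A: the newform `h` carrying the packet of `g`
  -- the Kronecker character and `ψ̃((m)) = κ(m) m^{k-1}`
  obtain ⟨κ, -, hodd, -, hκJ, hζ⟩ := exists_kroneckerChar_odd_jacobiSym_dedekindZeta (K := K) hK2
  have hηκ : ∀ m : ℕ, m.Coprime N₀ → idealPow K ψ (Ideal.span {(m : 𝓞 K)}) = κ m * (m : ℂ) ^ (k - 1) := fun m hm ↦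
    idealPow_span_natCast_eq_kroneckerChar_mul_pow hK2 σ hk1 hκJ hψG hneb (by rw [← hN₀def]; exact hm)
  -- the `Γ₁`-lift of `g`
  set g₁ : CuspForm (Gamma1 N₀) (k : ℤ) := liftToGamma1 N₀ (k : ℤ) g with hg₁
  have hcoe₁ : (⇑g₁ : ℍ → ℂ) = ⇑g := coe_liftToGamma1_holds N₀ (k : ℤ) g
  have hgχ : g₁ ∈ nebentypusSubspace N₀ (k : ℤ) 1 := MurtySinha.liftToGamma1_mem_nebentypusSubspace_one N₀ (k : ℤ) g
  have hq : ∀ n : ℕ, (qExpansion 1 ⇑g₁).coeff n = a n := by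
    intro n
    rw [hcoe₁]
    exact hga n
  have hq' : ∀ n : ℕ, 0 < n → (qExpansion 1 ⇑g₁).coeff n =
      ∑ᶠ I ∈ {I : Ideal (𝓞 K) | Ideal.absNorm I = n}, rayClassCoeff 𝔣 ψ I := fun n _ ↦ hq n
  have ha1 : a 1 = 1 := thetaCoeff_one 𝔣 ψ
  have hg0 : g₁ ≠ 0 := by
    intro h
    have h1 := hq 1
    rw [h, ha1] at h1
    have : (qExpansion 1 (⇑(0 : CuspForm (Gamma1 N₀) (k : ℤ)))).coeff 1 = 0 := by
      rw [CuspForm.coe_zero, UpperHalfPlane.qExpansion_zero]; simp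
    rw [this] at h1
    exact zero_ne_one h1
  -- places over primes away from the level
  have hunr : ∀ v : HeightOneSpectrum (𝓞 ℚ), ¬ Rat.HeightOneSpectrum.natGenerator v ∣ N₀ →
      v.asIdeal.ramificationIdxIn (𝓞 K) = 1 := fun v hv ↦
    ramificationIdxIn_eq_one_of_not_dvd_level K v (by rw [hN₀def]; exact dvd_mul_right _ _) hv
  have hwv : ∀ {v : HeightOneSpectrum (𝓞 ℚ)} {w : HeightOneSpectrum (𝓞 K)},
      w.asIdeal.under (𝓞 ℚ) = v.asIdeal → w.under (𝓞 ℚ) = v := fun hw ↦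
    HeightOneSpectrum.ext (by rw [HeightOneSpectrum.under_asIdeal]; exact hw)
  have hcop : ∀ v : HeightOneSpectrum (𝓞 ℚ), ¬ Rat.HeightOneSpectrum.natGenerator v ∣ N₀ →
      ∀ w : HeightOneSpectrum (𝓞 K), w.asIdeal.under (𝓞 ℚ) = v.asIdeal → IsCoprime w.asIdeal 𝔣 := by
    intro v hv w hw
    rw [isCoprime_asIdeal_iff_not_le]
    intro hle
    have hdvd : Ideal.absNorm w.asIdeal ∣ Ideal.absNorm 𝔣 := Ideal.absNorm_dvd_absNorm_of_le hle
    have hp : Rat.HeightOneSpectrum.natGenerator v ∣ Ideal.absNorm w.asIdeal := by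
      rw [absNorm_asIdeal_eq_natGenerator_pow, hwv hw]
      exact dvd_pow_self _ (Ideal.inertiaDeg_pos (R := 𝓞 ℚ) (q := w.asIdeal)).ne'
    exact hv ((hp.trans hdvd).trans (by rw [hN₀def]; exact dvd_mul_left _ _))
  have hψp : ∀ v : HeightOneSpectrum (𝓞 ℚ), ¬ Rat.HeightOneSpectrum.natGenerator v ∣ N₀ →
      idealPow K ψ (Ideal.span {((Rat.HeightOneSpectrum.natGenerator v : ℕ) : 𝓞 K)}) =
        κ (Rat.HeightOneSpectrum.natGenerator v) * (Rat.HeightOneSpectrum.natGenerator v : ℂ) ^ (k - 1) := fun v hv ↦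
    hηκ _ ((Nat.Prime.coprime_iff_not_dvd (Rat.HeightOneSpectrum.prime_natGenerator v)).mpr hv)
  have hone : ∀ v : HeightOneSpectrum (𝓞 ℚ), ¬ Rat.HeightOneSpectrum.natGenerator v ∣ N₀ →
      (1 : DirichletCharacter ℂ N₀) (Rat.HeightOneSpectrum.natGenerator v : ZMod N₀) = 1 := by
    intro v hv
    have hu : IsUnit (Rat.HeightOneSpectrum.natGenerator v : ZMod N₀) :=
      (ZMod.isUnit_iff_coprime _ _).mpr
        ((Nat.Prime.coprime_iff_not_dvd (Rat.HeightOneSpectrum.prime_natGenerator v)).mpr hv)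
    exact MulChar.one_apply hu
  have hsplit : ∀ v : HeightOneSpectrum (𝓞 ℚ), ¬ Rat.HeightOneSpectrum.natGenerator v ∣ N₀ →
      (∃ w₁ w₂ : HeightOneSpectrum (𝓞 K), w₁ ≠ w₂ ∧
        w₁.asIdeal.under (𝓞 ℚ) = v.asIdeal ∧ w₂.asIdeal.under (𝓞 ℚ) = v.asIdeal) →
      (1 : DirichletCharacter ℂ N₀) (Rat.HeightOneSpectrum.natGenerator v : ZMod N₀) *
          (Rat.HeightOneSpectrum.natGenerator v : ℂ) ^ ((k : ℤ) - 1) =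
        idealPow K ψ (Ideal.span {((Rat.HeightOneSpectrum.natGenerator v : ℕ) : 𝓞 K)}) := by
    intro v hv hpair
    rw [hone v hv, hψp v hv, hzpow]
    rcases exists_places_eq_pair_or_eq_singleton hK2 v (hunr v hv) with
      ⟨w₁, w₂, hne, hS, h₁, h₂⟩ | ⟨w, hS, hw⟩
    · rw [kroneckerChar_natGenerator_eq_one_of_pair hζ v hne hS h₁ h₂]
    · exfalso
      obtain ⟨w₁, w₂, hne, hw₁, hw₂⟩ := hpair
      have h1 : w₁ ∈ ({w} : Set (HeightOneSpectrum (𝓞 K))) := by rw [← hS]; exact hw₁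
      have h2 : w₂ ∈ ({w} : Set (HeightOneSpectrum (𝓞 K))) := by rw [← hS]; exact hw₂
      rw [Set.mem_singleton_iff] at h1 h2
      exact hne (h1.trans h2.symm)
  have hinert : ∀ v : HeightOneSpectrum (𝓞 ℚ), ¬ Rat.HeightOneSpectrum.natGenerator v ∣ N₀ →
      (∃ w : HeightOneSpectrum (𝓞 K), w.asIdeal.under (𝓞 ℚ) = v.asIdeal ∧
        w.asIdeal.inertiaDeg (𝓞 ℚ) = 2) →
      (1 : DirichletCharacter ℂ N₀) (Rat.HeightOneSpectrum.natGenerator v : ZMod N₀) *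
          (Rat.HeightOneSpectrum.natGenerator v : ℂ) ^ ((k : ℤ) - 1) =
        -idealPow K ψ (Ideal.span {((Rat.HeightOneSpectrum.natGenerator v : ℕ) : 𝓞 K)}) := by
    intro v hv hsing
    rw [hone v hv, hψp v hv, hzpow]
    rcases exists_places_eq_pair_or_eq_singleton hK2 v (hunr v hv) with
      ⟨w₁, w₂, hne, hS, h₁, h₂⟩ | ⟨w, hS, hw⟩
    · exfalso
      obtain ⟨w, hwv', hf⟩ := hsing
      have hmem : w ∈ ({w₁, w₂} : Set (HeightOneSpectrum (𝓞 K))) := by rw [← hS]; exact hwv'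
      rcases hmem with h | h
      · rw [h, h₁] at hf; norm_num at hf
      · rw [Set.mem_singleton_iff] at h; rw [h, h₂] at hf; norm_num at hf
    · rw [kroneckerChar_natGenerator_eq_neg_one_of_singleton hζ v hS hw]; ring
  -- the newform on `Γ₁`, descended to `Γ₀`
  obtain ⟨M₀, hM₀ne, hM₀, g₂, hnew1, hpack, hchar⟩ :=
    exists_isNewform1_of_cm_qExpansion hK2 𝔣 ψ hg0 hgχ hq' hunr hcop hsplit hinert
  haveI := hM₀ne
  have hε : nebentypus g₂ = 1 := (DirichletCharacter.changeLevel_eq_one_iff hM₀).mp hchar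
  obtain ⟨h, hh, hcoeh⟩ := Literature.NumberTheory.Automorphic.BCDT.exists_isNewform0_coe_eq_of_nebentypus_eq_one hnew1 hε
  -- the packet: `T_p g = a_p(h) g` for `p ∤ N₀`
  have hT : ∀ (p : ℕ) (hp : p.Prime), ¬ p ∣ N₀ →
      (haveI : NeZero p := ⟨hp.ne_zero⟩; heckeT (Gamma0 N₀) (k : ℤ) p g) = cuspCoeff h p • g := by
    intro p hp hpN
    haveI : NeZero p := ⟨hp.ne_zero⟩
    obtain ⟨v, hv⟩ : ∃ v : HeightOneSpectrum (𝓞 ℚ), Rat.HeightOneSpectrum.natGenerator v = p :=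
      ⟨(Rat.HeightOneSpectrum.primesEquiv (R := 𝓞 ℚ)).symm ⟨p, hp⟩,
        congrArg Subtype.val ((Rat.HeightOneSpectrum.primesEquiv (R := 𝓞 ℚ)).apply_symm_apply _)⟩
    subst hv
    have hT1 := heckeT_eq_smul_of_cm_qExpansion hK2 𝔣 ψ g₁ hgχ hq' v hpN (hunr v hpN) (hcop v hpN) (hsplit v hpN)
      (hinert v hpN)
    -- transport to `Γ₀` along the injective lift
    have hlift := heckeT_liftToGamma1 N₀ (k : ℤ) (Rat.HeightOneSpectrum.natGenerator v) g
    rw [← hg₁, hT1, hq, ← hga, ← map_smul] at hlift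
    have hcoe : (⇑(heckeT (Gamma0 N₀) (k : ℤ) (Rat.HeightOneSpectrum.natGenerator v) g) : ℍ → ℂ) =
        ⇑(cuspCoeff g (Rat.HeightOneSpectrum.natGenerator v) • g) := by
      rw [← coe_liftToGamma1_holds N₀ (k : ℤ), ← hlift, coe_liftToGamma1_holds N₀ (k : ℤ)]
    have heq := DFunLike.coe_injective hcoe
    rw [heq]
    congr 1
    have h2 : cuspCoeff h (Rat.HeightOneSpectrum.natGenerator v) = cuspCoeff g₂ (Rat.HeightOneSpectrum.natGenerator v) := by
      simp only [cuspCoeff, hcoeh]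
    rw [h2, hpack _ hp hpN, hga]
  -- ## Step B: the arithmetic of the coefficients of `g`
  have h1 : cuspCoeff g 1 = 1 := by rw [hga, ha1]
  have hmul : ∀ m n : ℕ, m.Coprime n → cuspCoeff g (m * n) = cuspCoeff g m * cuspCoeff g n := by
    intro m n hmn
    rw [hga, hga, hga]
    exact thetaCoeff_mul_of_coprime 𝔣 ψ hmn
  have hbad : ∀ ℓ : ℕ, ℓ.Prime → ℓ ∣ N₀ →
      (∀ j : ℕ, cuspCoeff g (ℓ ^ j) = cuspCoeff g ℓ ^ j) ∧ ‖cuspCoeff g ℓ‖ ^ 2 ≠ (ℓ : ℝ) ^ ((k : ℤ) - 2) := by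
    intro ℓ hℓ hℓN
    rw [hN₀def] at hℓN
    obtain ⟨b, hb, hb'⟩ := thetaCoeff_prime_pow_of_dvd_level 𝔣 ψ hK2 h𝔣 hℓ hℓN
    have hgb : cuspCoeff g ℓ = b := by
      have h := hb 1
      rw [pow_one, pow_one] at h
      rw [hga]; exact h
    refine ⟨fun j ↦ by rw [hga, hgb]; exact hb j, ?_⟩
    rw [hgb]
    have hℓR : (0 : ℝ) < ℓ := by exact_mod_cast hℓ.pos
    rcases hb' with rfl | ⟨w, hw, hNw, rfl⟩
    · rw [norm_zero, zero_pow two_ne_zero]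
      exact (zpow_pos hℓR _).ne
    · rw [norm_apply_sq_of_isGrossencharakter_weight hK2 h𝔣 hψG hw, hNw]
      intro heq
      have := zpow_right_injective₀ hℓR (by exact_mod_cast hℓ.one_lt.ne') heq
      omega
  -- ## Step C: the functional equation `Λ_N(g,s) = W·Λ_N(g^ρ, k−s)` from Hecke's
  set g' : CuspForm (Gamma0 N₀) (k : ℤ) := epsConj0 g with hg'def
  have hconj : ∀ n : ℕ, cuspCoeff g' n = conj (cuspCoeff g n) := fun n ↦ cuspCoeff_epsConj0 g n
  set χ := heckeOfGross h𝔣 hψG with hχdef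
  have hcond : HeckeCharacter.conductor χ = 𝔣 := hψG.conductor_eq_of_primitive h𝔣 hprim
  -- `L(g,s) = L(χ,s)`, `L(g',s) = conj L(χ, conj s) = heckeLFunctionConj χ s`
  have hLg : ∀ s : ℂ, ((k : ℤ) : ℝ) / 2 + 1 < s.re → cuspFormLSeries g s = heckeLFunction χ s := by
    intro s hs
    rw [cuspFormLSeries, LSeries_congr (f := cuspCoeff g) (g := a) (fun {n} _ ↦ hga n) s]
    exact LSeries_thetaCoeff_eq_heckeLFunction hK2 h𝔣 hψG hprim (by push_cast at hs ⊢; linarith)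
  have hLg' : ∀ s : ℂ, ((k : ℤ) : ℝ) / 2 + 1 < s.re → cuspFormLSeries g' s = heckeLFunctionConj χ s := by
    intro s hs
    rw [heckeLFunctionConj_eq_conj, ← hLg (conj s) (by rwa [Complex.conj_re]), cuspFormLSeries, cuspFormLSeries,
      LSeries_congr (f := cuspCoeff g') (g := fun n ↦ conj (cuspCoeff g n)) (fun {n} _ ↦ hconj n) s]
    exact LSeries_conj' _ s
  -- the weight `m = k − 1 ≥ 1`
  obtain ⟨m, hm⟩ : ∃ m : ℕ, k = m + 1 := ⟨k - 1, by omega⟩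
  have hm0 : 0 < m := by omega
  have hmk : ((k : ℤ) - 1 : ℤ) = (m : ℤ) := by omega
  have hmk' : ((m : ℂ) + 1) = ((k : ℤ) : ℂ) := by rw [hm]; push_cast; ring
  have hhalf : ∀ s : ℂ, ((k : ℤ) : ℝ) / 2 + 1 < s.re → (m : ℝ) / 2 + 1 < s.re := by
    intro s hs; rw [hm] at hs; push_cast at hs ⊢; linarith
  -- the infinity type is `(m, 0)` or `(0, m)`
  have hinf := heckeOfGross_hasInfinityType h𝔣 hψG
  obtain ⟨w₀⟩ : Nonempty (InfinitePlace K) := inferInstance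
  have hIQ : IsImaginaryQuadratic K := ⟨hK2, htc⟩
  -- continuation data from the fact, for `χ` or `χ̄`
  have hcontΛ : ∀ (Λ : ℂ → ℂ), Differentiable ℂ Λ →
      (∀ s : ℂ, (m : ℝ) / 2 + 1 < s.re →
        Λ s = (((discr K).natAbs * Ideal.absNorm 𝔣 : ℕ) : ℂ) ^ (s / 2) * (2 * Real.pi : ℂ) ^ (-s) * Complex.Gamma s *
          heckeLFunction χ s) → Λ ∈ completedCuspFormLContinuations N₀ g := by
    intro Λ hΛ hagree
    refine ⟨hΛ, fun s hs ↦ ?_⟩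
    rw [hagree s (hhalf s hs), completedCuspFormL, hLg s hs, hN₀def]
  have hcontΛ' : ∀ (Λ : ℂ → ℂ), Differentiable ℂ Λ →
      (∀ s : ℂ, (m : ℝ) / 2 + 1 < s.re →
        Λ s = (((discr K).natAbs * Ideal.absNorm 𝔣 : ℕ) : ℂ) ^ (s / 2) * (2 * Real.pi : ℂ) ^ (-s) * Complex.Gamma s *
          heckeLFunctionConj χ s) → Λ ∈ completedCuspFormLContinuations N₀ g' := by
    intro Λ hΛ hagree
    refine ⟨hΛ, fun s hs ↦ ?_⟩
    rw [hagree s (hhalf s hs), completedCuspFormL, hLg' s hs, hN₀def]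
  have hFE : ∃ (W : ℂ) (Λ Λ' : ℂ → ℂ), Λ ∈ completedCuspFormLContinuations N₀ g ∧
      Λ' ∈ completedCuspFormLContinuations N₀ g' ∧ ∀ s : ℂ, Λ s = W * Λ' ((k : ℤ) - s) := by
    have hsum₀ := (embType_add_embTypeConj_eq_one hK2 σ w₀).1
    by_cases hσ : embType σ w₀ = 1
    · -- type `(m, 0)`: apply the fact to `χ`
      have hq₀ : embTypeConj σ w₀ = 0 := by omega
      have htype : χ.HasInfinityType (fun _ ↦ (m : ℤ)) (fun _ ↦ 0) := by
        convert hinf using 2 with w w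
        · rw [infinitePlace_eq hK2 w w₀, hσ, mul_one, hmk]
        · rw [infinitePlace_eq hK2 w w₀, hq₀, mul_zero]
      obtain ⟨W, Λ, Λ', -, hΛ, hΛ', hagree, hFEq⟩ := hHecke K hIQ χ m hm0 htype
      rw [hcond] at hagree
      refine ⟨W, Λ, Λ', hcontΛ Λ hΛ (fun s hs ↦ (hagree s hs).1), hcontΛ' Λ' hΛ' (fun s hs ↦ (hagree s hs).2), fun s ↦ ?_⟩
      rw [hFEq s, hmk']
    · -- type `(0, m)`: apply the fact to `χ̄`
      have hp₀ : embType σ w₀ = 0 := by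
        unfold embType at hσ ⊢
        split_ifs with h
        · exact absurd (if_pos h) hσ
        · rfl
      have hq₀ : embTypeConj σ w₀ = 1 := by omega
      have htype0 : χ.HasInfinityType (fun _ ↦ (0 : ℤ)) (fun _ ↦ (m : ℤ)) := by
        convert hinf using 2 with w w
        · rw [infinitePlace_eq hK2 w w₀, hp₀, mul_zero]
        · rw [infinitePlace_eq hK2 w w₀, hq₀, mul_one, hmk]
      have htype : χ.conjugate.HasInfinityType (fun _ ↦ (m : ℤ)) (fun _ ↦ 0) := htype0.conjugate
      obtain ⟨W, Λ, Λ', hW, hΛ, hΛ', hagree, hFEq⟩ := hHecke K hIQ χ.conjugate m hm0 htype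
      rw [HeckeCharacter.conductor_conjugate, hcond] at hagree
      have hW0 : W ≠ 0 := by
        intro h0; rw [h0, norm_zero] at hW; exact zero_ne_one hW
      -- `L(χ̄, s) = heckeLFunctionConj χ s` and `heckeLFunctionConj χ̄ s = L(χ, s)`
      have hL1 : ∀ s, heckeLFunction χ.conjugate s = heckeLFunctionConj χ s := fun s ↦ heckeLFunction_conjugate χ s
      have hL2 : ∀ s, heckeLFunctionConj χ.conjugate s = heckeLFunction χ s := fun s ↦ by
        rw [← heckeLFunction_conjugate χ.conjugate s, HeckeCharacter.conjugate_conjugate]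
      refine ⟨W⁻¹, Λ', Λ, hcontΛ Λ' hΛ' (fun s hs ↦ by rw [(hagree s hs).2, hL2]),
        hcontΛ' Λ hΛ (fun s hs ↦ by rw [(hagree s hs).1, hL1]), fun s ↦ ?_⟩
      have := hFEq (((k : ℤ) : ℂ) - s)
      rw [hmk', sub_sub_cancel] at this
      rw [this, ← mul_assoc, inv_mul_cancel₀ hW0, one_mul]
  exact isNewform0_of_functionalEquation_conj hh hM₀ hT h1 hmul (fun ℓ hℓ hℓN ↦ (hbad ℓ hℓ hℓN).1)
    (fun ℓ hℓ hℓN ↦ (hbad ℓ hℓ hℓN).2) hconj hFE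

/-- ★★ **Shimura's remark (Ribet 1977 §3 Remark (3.5); Shimura 1971/72; Miyake Thm. 4.8.2) FOLLOWS from Hecke's functional equation with
conductor**: granted `Hecke_functionalEquation_infinityType_conductor` (Hecke 1920 / de Shalit II.1.1 (1)–(3), the conductor factor
`(|d_K|·N𝔣_χ)^{s/2}` pinned), the theta series of a PRIMITIVE Größencharakter `ψ mod 𝔣` of type `σ^{k−1}` of an imaginary quadratic field
with trivial Nebentypus is a newform of level exactly `|d_K|·N𝔣` — the named fact `shimura1972_heckeTheta_isNewform0_of_primitive` VERBATIM.
Proof: Li's criterion against the conjugate form (`isNewform0_of_functionalEquation_conj`), see the module docstring.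
[cite: Ribet1977Nebentypus, §3 Remark (3.5) (LNM 601, p. 35)] [cite: Shimura1972ClassFieldsRealQuadratic, p. 138]
[cite: Miyake2006, Thm. 4.8.2] [cite: Li1975, Thm. 9] -/
theorem shimura1972_heckeTheta_isNewform0_of_primitive_of_heckeFE (hHecke : Hecke_functionalEquation_infinityType_conductor) :
    shimura1972_heckeTheta_isNewform0_of_primitive := by
  intro K _ _ hK2 htc σ k hk 𝔣 h𝔣 ψ hψG hprim hneb _ g hcoeff
  exact isNewform0_of_heckeTheta_primitive_of_heckeFE hHecke hK2 htc σ k hk 𝔣 h𝔣 ψ hψG hprim hneb rfl g hcoeff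

end Literature.NumberTheory.EllipticCurves.ModularForms

end
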